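import Summits.Ventures.AbcSig.Rows.StatementsC1b
import Summits.Ventures.AbcSig.Rows.XnA7Yn37Z2V2X

/-!
# Venture AbcSig — CELL bridge for `xⁿ + 2^α yⁿ = 37 z²` (`7 ≤ α < n`): p1's census predicate `Rows.C1bCell 37 Rows.AlphaGe7Reduced 11 ∅`

HONEST FRAMING. COMPUTATION cell `pub-abcsig`; CONDITIONAL theorem; no claim on ABC or any summit. Hypotheses exactly
those of `Rows/XnA7Yn37Z2V2X.lean` (`xrow_XnA7Yn37Z2V2`): `BS04Package` (CITED), `DataComplete` (COMPUTED, certified engine level file), `EisChiPackage` (CITED) + `Refines` (COMPUTED) for the kernel M6χ discharge at 2738.12 @ 19, and the row's per-orbit CITED exclusions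
`hX_…` universally quantified in the exponent. Conclusion = p1's statement of the SIGNED row of record
`census/rows/C1b/C1b-C37-a7plus.md` (sha16 `eeaacd143d4eb62f`) in the census vocabulary
(`Rows/Statements.lean`, `Rows/StatementsC1b.lean`). GENERATED by p-lean g4 `gen4/cprow.py` (pattern of `Rows/XnYn14Z2XCell.lean`).
-/

namespace Summit.Ventures.AbcSig

/-- `xⁿ + 2^α yⁿ = 37 z²` (`7 ≤ α < n`): p1's `Rows.C1bCell 37 Rows.AlphaGe7Reduced 11 ∅` from `xrow_XnA7Yn37Z2V2` (hypotheses as there, `hX_…` for every exponent). -/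
theorem C1bCell_37_a7plus_v2_of (M : NewformModel) (hP : M.BS04Package) (hEχ : M.EisChiPackage)
    (hD2738 : M.DataComplete 2738 level2738Orbits)
    (hRc_orbit_2738_12 : M.Refines 2738 orbit_2738_12 m6chiX_2738_12)
    (hX_orbit_2738_9 : ∀ n : ℕ, n ∈ ([11] : List ℕ) → M.Excludes 2738 orbit_2738_9 (famBCge7 37 n))
    (hX_orbit_2738_10 : ∀ n : ℕ, n ∈ ([11] : List ℕ) → M.Excludes 2738 orbit_2738_10 (famBCge7 37 n)) :
    Rows.C1bCell 37 Rows.AlphaGe7Reduced 11 ∅ := by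
  intro n hn h11 hC _ α hα x y z h1 h2
  exact xrow_XnA7Yn37Z2V2 M hP hEχ hD2738 hRc_orbit_2738_12 n hn h11 hC α hα.1 hα.2 (hX_orbit_2738_9 n) (hX_orbit_2738_10 n) x y z h1 h2

/-- p1's named statement of the v2 row of record, `Rows.C1bC37A7plusV2Signed` (`Rows/StatementsC1b.lean`; definitionally the cell above). -/
theorem C1bC37A7plusV2Signed_of (M : NewformModel) (hP : M.BS04Package) (hEχ : M.EisChiPackage)
    (hD2738 : M.DataComplete 2738 level2738Orbits)
    (hRc_orbit_2738_12 : M.Refines 2738 orbit_2738_12 m6chiX_2738_12)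
    (hX_orbit_2738_9 : ∀ n : ℕ, n ∈ ([11] : List ℕ) → M.Excludes 2738 orbit_2738_9 (famBCge7 37 n))
    (hX_orbit_2738_10 : ∀ n : ℕ, n ∈ ([11] : List ℕ) → M.Excludes 2738 orbit_2738_10 (famBCge7 37 n)) :
    Rows.C1bC37A7plusV2Signed :=
  C1bCell_37_a7plus_v2_of M hP hEχ hD2738 hRc_orbit_2738_12 hX_orbit_2738_9 hX_orbit_2738_10

end Summit.Ventures.AbcSig
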